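import Summits.SmoothPoincare4.SmoothPoincare4.Theses.CylinderEntropy
import Summits.SmoothPoincare4.SmoothPoincare4.Theorems.CylinderEntropyCylinderRungTwoImmortalLeafRecognition
import HarnessLib

/-!
# Item `NearSliceRecognition` (stmt-SmoothPoincare4-18046, route CylinderEntropy; split piece X₂ of the deciding crux
# `CylinderRungTwo`) — CHECKED SKELETON, line `cms-recognition`

Planner (crux-strategist of stmt-SmoothPoincare4-7631, 2026-08-17).  The item is PROVED modulo one published theorem: the two
registered stubs are the Literature named fact `ChodoshMantoulidisSchulze2025_cor15b_four` (Chodosh–Mantoulidis–Schulze 2025,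
Cor. 1.5 (b), `n = 4`, simply connected case — statement only, D-0014) and the mid-scale kernel certificates (LANDED,
computational: `certMid_all` / `KillingFlux.stub_certMid`, axiom `Lean.ofReduceBool`, hence sorried here to keep standard axioms),
and the composition is the landed `helper_simplyConnectedRecognition` (conformal domination with constant `1.47`).
Hardest stub: `stub_cor15bFour` (a published theorem; not to be attacked — cite).  Disproof used: none of the parent's
`Disproof.lean` obstructions concern this item (it is not implied by SPC4: it speaks of non-separating simply connected
cross-sections such as `S² × S²`-type ones as well).
-/

noncomputable section

set_option linter.dupNamespace false

open scoped Manifold ContDiff ENNReal Topology BigOperators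

namespace Summit.SmoothPoincare4.SmoothPoincare4.Cruxes.NearSliceRecognition.CmsRecognition

open Summit.SmoothPoincare4.SmoothPoincare4.Cruxes.CylinderRungTwo.KillingFlux

/-- STUB 1 · CHODOSH–MANTOULIDIS–SCHULZE 2025, Cor. 1.5 (b) for `n = 4`, simply connected case: the Literature named fact
(statement only). [size XL; published named fact — cite, do not attack]
[cite: ChodoshMantoulidisSchulze2025, Cor. 1.5 (b) and Cor. 1.22 (b) (n = 4)] -/
theorem stub_cor15bFour : Literature.Geometry.Riemannian.ChodoshMantoulidisSchulze2025_cor15b_four := by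
  sorry

/-- STUB 2 · THE MID-SCALE KERNEL CERTIFICATES on `[10⁻², 10]` (LANDED, computational: `certMid_all`; sorried here for standard
axioms, exactly as in the skeletons of cruxes 7631 / 7632). [folklore] -/
theorem stub_certMid :
    ∀ T : ℝ, 1 / 100 ≤ T → T ≤ 10 → ∃ (n : ℕ) (σ τ w : Fin n → ℝ) (c : ℝ), (∀ j, 0 < τ j) ∧ (∀ j, 0 ≤ w j) ∧ 0 ≤ c ∧ (∑ j, w j) + c ≤ 147 / 100 ∧ ∀ u s : ℝ, -1 ≤ s → s ≤ 1 → (8 * Real.pi ^ 2 / 3) * ((4 * Real.pi * T) ^ 2)⁻¹ * Real.exp (4 * u) * Real.exp (-(Real.exp (2 * u) - 2 * Real.exp u * s + 1) / (4 * T)) ≤ (∑ j, w j * (Literature.Geometry.Riemannian.SphericalCylinderEntropy.zonal (τ j) s * Real.exp (-(u - σ j) ^ 2 / (4 * τ j)))) + c := by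
  sorry

/-- **THE COMPOSITION `CylinderEntropy.NearSliceRecognition` from the two registered stubs BY NAME** (route decl) — the landed
`helper_simplyConnectedRecognition stub_cor15bFour stub_certMid`. [cite: ChodoshMantoulidisSchulze2025, Cor. 1.5 (b)] -/
theorem NearSliceRecognition_of :
    Summit.SmoothPoincare4.SmoothPoincare4.Theses.CylinderEntropy.NearSliceRecognition :=
  helper_simplyConnectedRecognition stub_cor15bFour stub_certMid

end Summit.SmoothPoincare4.SmoothPoincare4.Cruxes.NearSliceRecognition.CmsRecognition

end
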